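/- Copyright: the b2b-balaban cell (near-miss cell 7), T⁴-continuum fan-out; row NE7b CRUX team (2), OWNER seat
t4-ne7b-p1 (gen 54) — (α)-JOINT FOR EVERY FAMILY: the joint witness for ALL `F : T4Family`, at record dimension `1` and at
the census dimension `4` (answers the refuter's R-v25-1).  Released under the licence of the surrounding project. -/
import Summits.QuantumFields.BalabanUV.T4Continuum.Support.HistoryRealiseCellsRunAssemblyWTVSJointRecordD
import Summits.QuantumFields.BalabanUV.T4Continuum.Support.HistoryRealiseCellsRunAssemblyWTVSJointWitness
import Summits.QuantumFields.BalabanUV.T4Continuum.Support.HistoryRealiseCellsRunAssemblyWTVSJointLetters13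

/-!
# (α)-JOINT FOR EVERY FAMILY: `∀ F : T4Family, ContinuumYM4Torus (jointData F)` THROUGH THE TERMINAL THEOREM OF RECORD, AT
RECORD DIMENSION `d = 1` (`sS = 12`) AND AT THE CENSUS DIMENSION `d = 4` WITH `M = 13`, `β₀ = 1∕7` (`sS = 34`)
(owner lineage `t4-ne7b-p1` gen 54; answers refuter PRICING-NE7b v25 R-v25-1 ∕ L-v25-2)

Summits-side support leaf of the T⁴-continuum cell (rung (B)+1 on a FINITE torus only; NOT infinite volume, NOT the
mass gap, NOT Clay; NOT a proof of NE7b — the cell's OWN estimate, NOT PRINTED, NOT PROVED).  [decided toy] over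
`JointRecordD.histReadDataLWL₆`, `JointWitness` (§1: `ZD_jointData…`), `JointDatum`, `JointReading.flowRows_of_tuned`,
`JointLetters` (`birthMass_Cj_…`), `JointLetters13` (`O₄`, `cth_32_1_34`), REUSED BY NAME; two `def`s (the FAMILY-INDEXED
constants `C1F F`, `C4F F`), nothing printed asserted, no `def … : Prop` fact, no cite-tagged hypothesis, zero `sorry`.

WHY.  `…JointWitness.continuumYM4Torus_jointData` (p306709) and `…JointWitness13.continuumYM4Torus_jointData₁₃` fix ONE
family each (`L = 87781`, resp. `L = 13`) because their constants fix `κ₁`.  The refuter (PRICING-NE7b v25 §6²⁴, R-v25-1 ∕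
L-v25-2) located that with `κ₁ := F.L + 2`, `β₀ := b₀ := 1∕F.L` and `(sS, θc) := (12, 19∕20)` the seventeen letters hold
for EVERY family at `d = 1` (`hsmall ⇐ 523380 ≤ 13⁶ ≤ F.L⁶`), so the witness reads `∀ F`.  THIS FILE does that, and the
same at the census dimension `d = 4` (`κ₁ := 4·F.L + 2`, `O₄`, `(sS, θc) := (34, 49∕50)`: `hsmall ⇐ (2245⁴)·5⁴·66·2 ≤ 13¹⁷
≤ F.L¹⁷`).

WHAT.  §1 `C1F F := ⟨13, 0, 3, 1, 1, F.L + 2, 2, 0, 1, 1∕2, 1, 5⟩`, `C4F F := ⟨13, 0, 6, 1, 1, 4·F.L + 2, 2, 0, 1, 1∕2, 1, 8⟩`;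
`thresholdOK_C1F`, `thresholdOK_C4F`; `joint_outside_C1F F` ∕ `joint_outside_C4F F` (the seventeen letters, every `F`).
§2 `forSmallCouplings_histReadDataLWL_jointData_C1F ∕ _C4F` (the terminal's `hRead` on `jointData F` at those constants,
record by `histReadDataLWL₆ 1` ∕ `histReadDataLWL₆ 4`).  §3 **`continuumYM4Torus_jointData_all (F)`** (at `d = 1`) and
**`continuumYM4Torus_jointData_all₄ (F)`** (at `d = 4`): `∀ F : T4Family, ContinuumYM4Torus (jointData F)` BY
`continuumYM4Torus_of_histReadingLWL_fsc`, + the ∃-forms.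

HONEST.  Same degenerate one-point-group datum `SU(1)` (no field, no action, no large field; (B) by the abstract
form-clause and `1 ≤ 1 ≤ 1`; H3-side fields VACUOUS on the no-region reading; NE7∕NE7c sockets exact at `e^t`); the
content is the ROUTE — the terminal theorem's whole antecedent inhabited at once, now for every admissible blocking
parameter `L` (odd, `> 11`) — not the conclusion.  Print's O(1)'s and every model constant remain UNVALUED symbols
(ρ = cΛ∕c_{E₂} UNVALUED).  Nothing of Bałaban's is discharged; every R-class row of the wall stays for real data; NE7b NOT
PRINTED ∕ NOT PROVED; spine 0∕9.  HONEST DEPENDENCY (cell): continuum YM on T⁴ ⇐ BetaPertH ∧ nine spine estimates (0/9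
proved); BetaPertH ⇐ (D1) ∧ (D4) ∧ CAP+tail; G-an2-4 gates asym, D1 and NE2/3/4.  Unchanged here.
-/

open Finset MeasureTheory
open Literature.MathematicalPhysics.QuantumFieldTheory.Balaban1983to89
open Literature.MathematicalPhysics.QuantumFieldTheory.Balaban1983to89.B16SProfile (DropCtl)
open Literature.MathematicalPhysics.QuantumFieldTheory.Balaban1983to89.T4ContinuumYM4Torus
open T4PersistenceDictionary T4PersistentHistoryCount T4BankedInduction T4PrintedShapeBanking
open T4WeightBudget T4GlobalDenominator T4LiveClassFibration T4LiveStructureGas T4LiveGasToTerms T4RecordPriceSeam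
open T4PartnerMultiplicity T4IndicatorShell T4MatchingAssembly T4MatchingClosure T4MatchingClosureSocket T4Continuum
open T4StabilitySocket T4BranchingRecordsGas T4TaggedShapeBanking T4CanonicalMenus T4RenewalChains
open Summit.QuantumFields.BalabanUV.T4Continuum.HistoryFlow Summit.QuantumFields.BalabanUV.T4Continuum.HistoryGen
open Summit.QuantumFields.BalabanUV.T4Continuum.HistoryGenealogyRealise
open Summit.QuantumFields.BalabanUV.T4Continuum.HistoryAssemblyRealiseRun
open Summit.QuantumFields.BalabanUV.T4Continuum.HistoryRealiseCellsRunApexT3bWTVS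
open Summit.QuantumFields.BalabanUV.T4Continuum.B16HistoryIndexedRepr
open Summit.QuantumFields.BalabanUV.T4Continuum.B16HistoryIndexedTrunc
open Summit.QuantumFields.BalabanUV.T4Continuum.HistoryConstants
open Summit.QuantumFields.BalabanUV.T4Continuum.HistoryRealiseCellsRunAssemblyWTVSDataLWL
open Summit.QuantumFields.BalabanUV.T4Continuum.HistoryRealiseCellsRunAssemblyWTVSLWLP82
open Summit.QuantumFields.BalabanUV.T4Continuum.HistoryRealiseCellsRunAssemblyWTVSSanity
open Summit.QuantumFields.BalabanUV.T4Continuum.HistoryRealiseCellsRunAssemblyWTVSJointReading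
open Summit.QuantumFields.BalabanUV.T4Continuum.HistoryRealiseCellsRunAssemblyWTVSJointReadingD
open Summit.QuantumFields.BalabanUV.T4Continuum.HistoryRealiseCellsRunAssemblyWTVSJointRecordD
open Summit.QuantumFields.BalabanUV.T4Continuum.HistoryRealiseCellsRunAssemblyWTVSJointDatum
open Summit.QuantumFields.BalabanUV.T4Continuum.HistoryRealiseCellsRunAssemblyWTVSJointWitness
open Summit.QuantumFields.BalabanUV.T4Continuum.HistoryRealiseCellsRunAssemblyWTVSJointLetters (Cj birthMass_Cj_le_one birthMass_Cj_nonneg)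
open Summit.QuantumFields.BalabanUV.T4Continuum.HistoryRealiseCellsRunAssemblyWTVSJointLetters13 (O₄ cth_32_1_34)
open Summit.QuantumFields.BalabanUV.T4Continuum.CountThresholdUniform (ThresholdOK)
open Summit.QuantumFields.BalabanUV.T4Continuum.HistoryZoneEvolve (cth)
open Summit.QuantumFields.BalabanUV.T4Continuum.HistoryBankingSharpShares (ell)
open Summit.QuantumFields.BalabanUV.T4Continuum.HistoryBankingVolumeWindowLattice (uvolL)

namespace Summit.QuantumFields.BalabanUV.T4Continuum.HistoryRealiseCellsRunAssemblyWTVSJointWitnessAll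

noncomputable section

-- the structural `DecidableEq` instance of the concrete tag type exceeds the default synthesis size (as in the siblings)
set_option synthInstance.maxSize 1024

open B16HistoryIndexedRepr.Sanity B16HistoryIndexedRepr.SanityInput HistoryConstants.Sanity

/-! ## §1 Family-indexed constants and the seventeen letters for every family -/

section Letters

variable (F : T4Family)

/-- THE FAMILY-INDEXED CONSTANTS AT `d = 1`: `Cj` with `κ₁ := F.L + 2` (refuter R-v25-1). [decided arithmetic] -/
def C1F : T4PrintedShapeBanking.Consts := ⟨13, 0, 3, 1, 1, (F.L : ℝ) + 2, 2, 0, 1, 1 / 2, 1, 5⟩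

/-- THE FAMILY-INDEXED CONSTANTS AT `d = 4`: `C₁₃` with `κ₁ := 4·F.L + 2`. [decided arithmetic] -/
def C4F : T4PrintedShapeBanking.Consts := ⟨13, 0, 6, 1, 1, 4 * (F.L : ℝ) + 2, 2, 0, 1, 1 / 2, 1, 8⟩

/-- `birthMass` reads only `(Eb, μ) = (0, 1)`: the same as `Cj`'s. [decided arithmetic] -/
theorem birthMass_C1F : T4CanonicalMenus.birthMass (C1F F) = T4CanonicalMenus.birthMass Cj := rfl

/-- idem at `d = 4` [decided arithmetic] -/
theorem birthMass_C4F : T4CanonicalMenus.birthMass (C4F F) = T4CanonicalMenus.birthMass Cj := rfl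

/-- `13 ≤ F.L` for every family (`L` odd and `> 11`). [folklore] -/
theorem thirteen_le_L : 13 ≤ F.L := by
  obtain ⟨⟨k, hk⟩, -⟩ := F.hL
  have := F.hL11
  omega

/-- `ThresholdOK (C1F F) F.L 1 (1∕F.L)`. [decided arithmetic] -/
theorem thresholdOK_C1F : ThresholdOK (C1F F) F.L 1 (1 / F.L) where
  valid :=
    { E₂_nonneg := by norm_num [C1F]
      E₃_nonneg := by norm_num [C1F]
      κ₁_nonneg := by simp only [C1F]; positivity
      E₀_nonneg := by norm_num [C1F]
      Eb_nonneg := by norm_num [C1F]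
      μ_nonneg := by norm_num [C1F]
      dC_le := by simp [C1F, T4PersistenceDictionary.fatWait] }
  a_pos := by norm_num [C1F]
  A₀_pos := by norm_num [C1F]
  one_le_L := le_trans (by norm_num) (thirteen_le_L F)
  β₀_nonneg := by positivity
  rq_lt := by simp [C1F]

/-- `ThresholdOK (C4F F) F.L 1 (1∕F.L)`. [decided arithmetic] -/
theorem thresholdOK_C4F : ThresholdOK (C4F F) F.L 1 (1 / F.L) where
  valid :=
    { E₂_nonneg := by norm_num [C4F]
      E₃_nonneg := by norm_num [C4F]
      κ₁_nonneg := by simp only [C4F]; positivity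
      E₀_nonneg := by norm_num [C4F]
      Eb_nonneg := by norm_num [C4F]
      μ_nonneg := by norm_num [C4F]
      dC_le := by simp [C4F, T4PersistenceDictionary.fatWait] }
  a_pos := by norm_num [C4F]
  A₀_pos := by norm_num [C4F]
  one_le_L := le_trans (by norm_num) (thirteen_le_L F)
  β₀_nonneg := by positivity
  rq_lt := by simp [C4F]

/-- the two shared analytic letters: `d·log L + 2 log 2 ≤ d·L + 2` and `log (2 + birthMass) ≤ 2` [decided arithmetic] -/
theorem log_letters (d : ℕ) :
    (d : ℝ) * Real.log F.L + 2 * Real.log 2 ≤ d * (F.L : ℝ) + 2 ∧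
      Real.log (2 + T4CanonicalMenus.birthMass Cj) ≤ 2 := by
  have hL : (13 : ℝ) ≤ F.L := by exact_mod_cast thirteen_le_L F
  have h1 : Real.log (F.L : ℝ) ≤ (F.L : ℝ) - 1 := Real.log_le_sub_one_of_pos (by linarith)
  have h2 : Real.log 2 < 1 := by have := Real.log_two_lt_d9; linarith
  have hd : (0 : ℝ) ≤ d := Nat.cast_nonneg d
  refine ⟨by nlinarith, ?_⟩
  have h3 : Real.log (2 + T4CanonicalMenus.birthMass Cj) ≤ 2 + T4CanonicalMenus.birthMass Cj - 1 :=
    Real.log_le_sub_one_of_pos (by linarith [birthMass_Cj_nonneg])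
  linarith [birthMass_Cj_le_one]

/-- **THE SEVENTEEN OUTSIDE LETTER BINDERS FOR EVERY FAMILY AT `d = 1`**: `(C, rr, β₀, d, n, θ, θv, O, sS, θc) = (C1F F, 1, 1∕F.L,
1, 1, 1∕8, 1∕8, O₁, 12, 19∕20)` (`hsmall ⇐ 261690 ≤ F.L⁶∕2`, from `13 ≤ F.L`). [decided arithmetic] -/
theorem joint_outside_C1F :
    0 < (C1F F).μ ∧
    ((1 : ℕ) : ℝ) * Real.log F.L + 2 * Real.log 2 ≤ (C1F F).κ₁ ∧
    Real.log (2 + T4CanonicalMenus.birthMass (C1F F)) ≤ (C1F F).E₀ ∧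
    1 ≤ (C1F F).A₀ ∧
    (0 : ℝ) < 1 / F.L ∧ (F.L : ℝ) * (1 / F.L) ≤ 1 ∧
    13 ≤ (C1F F).n₁ ∧ (0 : ℕ) < 1 ∧
    (0 : ℝ) < 1 / 8 ∧ (C1F F).a + (1 / 8 + 1 / 8) ≤ O₁.γ₀ * O₁.A₁ ^ 2 / 2 ∧
    0 < (C1F F).E₂ ∧ 0 ≤ (C1F F).E₃ ∧ (1 : ℕ) ≤ 12 ∧
    (((2 * cth 32 1 12 + 1) ^ 1 : ℕ) : ℝ) * (5 : ℝ) ^ 1 * ((max 1 (2 * 32 + 2) : ℕ) : ℝ) ≤ (F.L : ℝ) ^ (12 / 2) / 2 ∧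
    (0 : ℝ) ≤ 19 / 20 ∧ (19 / 20 : ℝ) < 1 ∧ (1 / 2 : ℝ) ≤ (19 / 20) ^ 12 := by
  have hL : (13 : ℝ) ≤ F.L := by exact_mod_cast thirteen_le_L F
  have hL0 : (0 : ℝ) < F.L := by linarith
  obtain ⟨hlog, hbm⟩ := log_letters F 1
  have hcth : cth 32 1 12 = 396 := by decide
  refine ⟨by norm_num [C1F], ?_, ?_, by norm_num [C1F], by positivity, ?_, by norm_num [C1F], one_pos, by norm_num, ?_,
    by norm_num [C1F], by norm_num [C1F], by norm_num, ?_, by norm_num, by norm_num, by norm_num⟩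
  · simp only [C1F, Nat.cast_one, one_mul] at hlog ⊢; linarith
  · rw [birthMass_C1F]; simp only [C1F]; exact hbm
  · rw [mul_one_div_cancel hL0.ne']
  · norm_num [C1F, O₁]
  · rw [hcth]
    have h6 : (13 : ℝ) ^ 6 ≤ (F.L : ℝ) ^ 6 := pow_le_pow_left₀ (by norm_num) hL 6
    norm_num at h6 ⊢
    linarith

/-- **THE SEVENTEEN OUTSIDE LETTER BINDERS FOR EVERY FAMILY AT THE CENSUS DIMENSION `d = 4`**: `(C, rr, β₀, d, n, θ, θv, O,
sS, θc) = (C4F F, 1, 1∕F.L, 4, 1, 1∕8, 1∕8, O₄, 34, 49∕50)` (`hsmall ⇐ (2245⁴)·5⁴·66 ≤ F.L¹⁷∕2`, from `13 ≤ F.L`).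
[decided arithmetic] -/
theorem joint_outside_C4F :
    0 < (C4F F).μ ∧
    ((4 : ℕ) : ℝ) * Real.log F.L + 2 * Real.log 2 ≤ (C4F F).κ₁ ∧
    Real.log (2 + T4CanonicalMenus.birthMass (C4F F)) ≤ (C4F F).E₀ ∧
    1 ≤ (C4F F).A₀ ∧
    (0 : ℝ) < 1 / F.L ∧ (F.L : ℝ) * (1 / F.L) ≤ 1 ∧
    13 ≤ (C4F F).n₁ ∧ (0 : ℕ) < 1 ∧
    (0 : ℝ) < 1 / 8 ∧ (C4F F).a + (1 / 8 + 1 / 8) ≤ O₄.γ₀ * O₄.A₁ ^ 2 / 2 ∧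
    0 < (C4F F).E₂ ∧ 0 ≤ (C4F F).E₃ ∧ (1 : ℕ) ≤ 34 ∧
    (((2 * cth 32 1 34 + 1) ^ 4 : ℕ) : ℝ) * (5 : ℝ) ^ 4 * ((max 1 (2 * 32 + 2) : ℕ) : ℝ) ≤ (F.L : ℝ) ^ (34 / 2) / 2 ∧
    (0 : ℝ) ≤ 49 / 50 ∧ (49 / 50 : ℝ) < 1 ∧ (1 / 2 : ℝ) ≤ (49 / 50) ^ 34 := by
  have hL : (13 : ℝ) ≤ F.L := by exact_mod_cast thirteen_le_L F
  have hL0 : (0 : ℝ) < F.L := by linarith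
  obtain ⟨hlog, hbm⟩ := log_letters F 4
  refine ⟨by norm_num [C4F], ?_, ?_, by norm_num [C4F], by positivity, ?_, by norm_num [C4F], one_pos, by norm_num, ?_,
    by norm_num [C4F], by norm_num [C4F], by norm_num, ?_, by norm_num, by norm_num, by norm_num⟩
  · simp only [C4F, Nat.cast_ofNat] at hlog ⊢; linarith
  · rw [birthMass_C4F]; simp only [C4F]; exact hbm
  · rw [mul_one_div_cancel hL0.ne']
  · norm_num [C4F, O₄]
  · rw [cth_32_1_34]
    have h17 : (13 : ℝ) ^ 17 ≤ (F.L : ℝ) ^ 17 := pow_le_pow_left₀ (by norm_num) hL 17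
    norm_num at h17 ⊢
    linarith

end Letters

/-! ## §2 The terminal's `hRead` on `jointData F` at the family-indexed constants -/

section Record

variable (F : T4Family)

/-- the record at `d = 1`, constants `C1F F`, on the joint datum (inputs as `JointWitness.histReadDataLWL_jointData`). [decided toy] -/
def histReadDataLWL_jointData_C1F {b₀ : ℝ} (hb₀ : 0 ≤ b₀) (β' : ℝ) (g₀ : ℕ → ℝ) (os : List (ULoop F)) (R : ℕ → ℕ → ℕ)
    (isRj : ∀ K s, s ≤ K → B14.IsRj F.L 1 (((jointData F).C ⟨K, F.m, g₀ K⟩).flow.g s) (R K s))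
    (hR2 : ∀ K t, 2 ≤ R K t)
    (h27 : ∀ K, B14.FlowIneq27 ((jointData F).C ⟨K, F.m, g₀ K⟩).flow.g β' b₀ 1 K)
    (h29 : ∀ K, B14FlowStep.FlowIneq29 (R K) ((jointData F).C ⟨K, F.m, g₀ K⟩).flow.g F.L β' b₀ K)
    (hprof : ∀ K t, t < K → runProfile F.L R K (t + 1) ≤ runProfile F.L R K t)
    (hdrop : ∀ K m, DropCtl (runProfile F.L R K) m)
    (hx1 : ∀ K s, s ≤ K → 1 ≤ Real.log ((((jointData F).C ⟨K, F.m, g₀ K⟩).flow.g s) ^ 2)⁻¹) :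
    HistReadDataLWL (jointData F) (C1F F) O₁ (1 / 8) 1 1 1 one_pos g₀ os 0 0 0 0 b₀ 6 3 4 6 1 8 Isk Isk (fun _ => Unit) μ₀
      (fun _ => GoodClass.top Unit) (fun _ => Unit) μ₀ (fun _ => GoodClass.top Unit) :=
  histReadDataLWL₆ 1 (jointData F) (avgMeasurable_jointData F) (C := C1F F) (O := O₁) (by norm_num [C1F])
    (by norm_num [C1F]) (by norm_num [C1F]) (by norm_num [C1F]) (by norm_num [C1F]) (by norm_num [O₁]) (by norm_num [O₁])
    (by norm_num [O₁]) (by norm_num [O₁]) (by norm_num) 1 1 one_pos g₀ os R hR2 le_rfl le_rfl le_rfl le_rfl hb₀ β' le_rfl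
    (by simp [C1F, O₁]) (by simp [C1F, O₁]) (by simp [C1F]) (by simp [C1F]) (by simp [C1F]) (by simp [C1F])
    (by norm_num) (by norm_num) (by norm_num) le_rfl (by norm_num) (ZD_jointData_le F g₀ os) isRj
    (fun K t => one_le_lamVolL le_rfl le_rfl (fun j hj => hx1 K j hj) t) h27 h29 hprof hdrop (c₀ := 1) (n₁ := 0)
    one_pos (fun K => (smallFieldMass_jointData F K _).symm.le) (fun K => (smallFieldMass_jointData F (K + 1) _).symm.le)
    (fun K => by simp) (fun K => by simp) (shell_toyR _)
    (budget_toyR (fun K t _ => ZD_jointData_pos F g₀ os K t) _ (ZD_jointData_succ F g₀ os) _)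
    summable_zero summable_zero summable_zero summable_zero

/-- the record at `d = 4`, constants `C4F F`, on the joint datum. [decided toy] -/
def histReadDataLWL_jointData_C4F {b₀ : ℝ} (hb₀ : 0 ≤ b₀) (β' : ℝ) (g₀ : ℕ → ℝ) (os : List (ULoop F)) (R : ℕ → ℕ → ℕ)
    (isRj : ∀ K s, s ≤ K → B14.IsRj F.L 1 (((jointData F).C ⟨K, F.m, g₀ K⟩).flow.g s) (R K s))
    (hR2 : ∀ K t, 2 ≤ R K t)
    (h27 : ∀ K, B14.FlowIneq27 ((jointData F).C ⟨K, F.m, g₀ K⟩).flow.g β' b₀ 1 K)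
    (h29 : ∀ K, B14FlowStep.FlowIneq29 (R K) ((jointData F).C ⟨K, F.m, g₀ K⟩).flow.g F.L β' b₀ K)
    (hprof : ∀ K t, t < K → runProfile F.L R K (t + 1) ≤ runProfile F.L R K t)
    (hdrop : ∀ K m, DropCtl (runProfile F.L R K) m)
    (hx1 : ∀ K s, s ≤ K → 1 ≤ Real.log ((((jointData F).C ⟨K, F.m, g₀ K⟩).flow.g s) ^ 2)⁻¹) :
    HistReadDataLWL (jointData F) (C4F F) O₄ (1 / 8) 1 4 1 one_pos g₀ os 0 0 0 0 b₀ 8 1 2 9 1 11 Isk Isk (fun _ => Unit) μ₀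
      (fun _ => GoodClass.top Unit) (fun _ => Unit) μ₀ (fun _ => GoodClass.top Unit) :=
  histReadDataLWL₆ 4 (jointData F) (avgMeasurable_jointData F) (C := C4F F) (O := O₄) (by norm_num [C4F])
    (by norm_num [C4F]) (by norm_num [C4F]) (by norm_num [C4F]) (by norm_num [C4F]) (by norm_num [O₄]) (by norm_num [O₄])
    (by norm_num [O₄]) (by norm_num [O₄]) (by norm_num) 1 1 one_pos g₀ os R hR2 le_rfl le_rfl le_rfl le_rfl hb₀ β' le_rfl
    (by simp [C4F, O₄]) (by simp [C4F, O₄]) (by simp [C4F]) (by simp [C4F]) (by simp [C4F]) (by simp [C4F])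
    le_rfl (by norm_num) (by norm_num) le_rfl (by norm_num) (ZD_jointData_le F g₀ os) isRj
    (fun K t => one_le_lamVolL le_rfl le_rfl (fun j hj => hx1 K j hj) t) h27 h29 hprof hdrop (c₀ := 1) (n₁ := 0)
    one_pos (fun K => (smallFieldMass_jointData F K _).symm.le) (fun K => (smallFieldMass_jointData F (K + 1) _).symm.le)
    (fun K => by simp) (fun K => by simp) (shell_toyR _)
    (budget_toyR (fun K t _ => ZD_jointData_pos F g₀ os K t) _ (ZD_jointData_succ F g₀ os) _)
    summable_zero summable_zero summable_zero summable_zero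

/-- **THE TERMINAL's `hRead` ON `jointData F` AT `d = 1`, CONSTANTS `C1F F`** (`b₀ := 1∕F.L`). [decided toy] -/
theorem forSmallCouplings_histReadDataLWL_jointData_C1F :
    ForSmallCouplings (jointData F) fun g₀ => ∀ os : List (ULoop F),
      ∃ (DomK : ℕ → Type) (I : (K : ℕ) → HIndex (DomK K)) (_ : DecidableEq (HIndex.Idx I)) (DomK' : ℕ → Type)
        (I' : (K : ℕ) → HIndex (DomK' K)) (X : ℕ → Type) (_ : ∀ K, MeasurableSpace (X K))
        (μ : (K : ℕ) → Measure (X K)) (_ : ∀ K, IsFiniteMeasure (μ K)) (𝒢 : (K : ℕ) → GoodClass (X K))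
        (Y : ℕ → Type) (_ : ∀ K, MeasurableSpace (Y K)) (νB : (K : ℕ) → Measure (Y K))
        (_ : ∀ K, IsFiniteMeasure (νB K)) (𝒢' : (K : ℕ) → GoodClass (Y K)),
        Nonempty (HistReadDataLWL (jointData F) (C1F F) O₁ (1 / 8) 1 1 1 one_pos g₀ os 0 0 0 0 (1 / (F.L : ℝ))
          6 3 4 6 1 8 I I' X μ 𝒢 Y νB 𝒢') := by
  have hL : (2 : ℝ) ≤ F.L := by exact_mod_cast two_le_L F
  have hb₀ : (0 : ℝ) < 1 / (F.L : ℝ) := by positivity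
  have hb₁ : 1 / (F.L : ℝ) ≤ 1 / 2 := one_div_le_one_div_of_le (by norm_num) hL
  have hLb : (F.L : ℝ) * (1 / (F.L : ℝ)) ≤ 1 := by rw [mul_one_div_cancel (by linarith)]
  obtain ⟨γ₁, hγ₁, β', hflow⟩ := flowRows_of_tuned (jointData F) (betaPertHyp_jointData F) hb₀ hb₁ hLb (rr := 1) le_rfl
  refine ⟨γ₁, hγ₁, fun γ hγ hγle => ⟨1, one_pos, fun g _ _ g₀ ht os => ?_⟩⟩
  obtain ⟨R, hR, hR2, h27, h29, hprof, hdrop, hx1⟩ := hflow γ hγ hγle g g₀ ht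
  exact ⟨_, Isk, inferInstance, _, Isk, fun _ => Unit, inferInstance, μ₀, inferInstance, _, fun _ => Unit,
    inferInstance, μ₀, inferInstance, _,
    ⟨histReadDataLWL_jointData_C1F F hb₀.le β' g₀ os R hR hR2 h27 h29 hprof hdrop hx1⟩⟩

/-- **THE TERMINAL's `hRead` ON `jointData F` AT `d = 4`, CONSTANTS `C4F F`** (`b₀ := 1∕F.L`). [decided toy] -/
theorem forSmallCouplings_histReadDataLWL_jointData_C4F :
    ForSmallCouplings (jointData F) fun g₀ => ∀ os : List (ULoop F),
      ∃ (DomK : ℕ → Type) (I : (K : ℕ) → HIndex (DomK K)) (_ : DecidableEq (HIndex.Idx I)) (DomK' : ℕ → Type)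
        (I' : (K : ℕ) → HIndex (DomK' K)) (X : ℕ → Type) (_ : ∀ K, MeasurableSpace (X K))
        (μ : (K : ℕ) → Measure (X K)) (_ : ∀ K, IsFiniteMeasure (μ K)) (𝒢 : (K : ℕ) → GoodClass (X K))
        (Y : ℕ → Type) (_ : ∀ K, MeasurableSpace (Y K)) (νB : (K : ℕ) → Measure (Y K))
        (_ : ∀ K, IsFiniteMeasure (νB K)) (𝒢' : (K : ℕ) → GoodClass (Y K)),
        Nonempty (HistReadDataLWL (jointData F) (C4F F) O₄ (1 / 8) 1 4 1 one_pos g₀ os 0 0 0 0 (1 / (F.L : ℝ))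
          8 1 2 9 1 11 I I' X μ 𝒢 Y νB 𝒢') := by
  have hL : (2 : ℝ) ≤ F.L := by exact_mod_cast two_le_L F
  have hb₀ : (0 : ℝ) < 1 / (F.L : ℝ) := by positivity
  have hb₁ : 1 / (F.L : ℝ) ≤ 1 / 2 := one_div_le_one_div_of_le (by norm_num) hL
  have hLb : (F.L : ℝ) * (1 / (F.L : ℝ)) ≤ 1 := by rw [mul_one_div_cancel (by linarith)]
  obtain ⟨γ₁, hγ₁, β', hflow⟩ := flowRows_of_tuned (jointData F) (betaPertHyp_jointData F) hb₀ hb₁ hLb (rr := 1) le_rfl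
  refine ⟨γ₁, hγ₁, fun γ hγ hγle => ⟨1, one_pos, fun g _ _ g₀ ht os => ?_⟩⟩
  obtain ⟨R, hR, hR2, h27, h29, hprof, hdrop, hx1⟩ := hflow γ hγ hγle g g₀ ht
  exact ⟨_, Isk, inferInstance, _, Isk, fun _ => Unit, inferInstance, μ₀, inferInstance, _, fun _ => Unit,
    inferInstance, μ₀, inferInstance, _,
    ⟨histReadDataLWL_jointData_C4F F hb₀.le β' g₀ os R hR hR2 h27 h29 hprof hdrop hx1⟩⟩

end Record

/-! ## §3 The joint witness for every family -/

/-- **FOR EVERY FAMILY `F` (every odd `L > 11`, every torus exponent), THE TERMINAL THEOREM OF RECORD APPLIES TO THE JOINT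
DATUM AT RECORD DIMENSION `d = 1`** (constants `C1F F`, `β₀ = b₀ = 1∕F.L`, `(sS, θc) = (12, 19∕20)`; refuter R-v25-1).
[decided toy] -/
theorem continuumYM4Torus_jointData_all (F : T4Family) : ContinuumYM4Torus (jointData F) := by
  obtain ⟨hμ, hκ₁, hE₀, hA₀, hβ₀, hLβ, hn₁, hn, hθ, hslack, hE₂, hE₃, hsS, hsmall, hθc0, hθc1, hθcs⟩ := joint_outside_C1F F
  exact continuumYM4Torus_of_histReadingLWL_fsc (jointData F) (isBlockAveraged_jointData F)
    LoopAverage.measurableE_trivial (endStatementBPrinted_jointData F) (betaPertHyp_jointData F)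
    (signConventions_jointData F) (thresholdOK_C1F F) hμ 1 1 hκ₁ hE₀ hA₀ hβ₀ hLβ hn₁ hn hθ hslack hE₂ hE₃ hsS hsmall hθc0
    hθc1 hθcs (forSmallCouplings_histReadDataLWL_jointData_C1F F)

/-- **… AND AT THE CENSUS DIMENSION `d = 4`** (constants `C4F F`, print's `M = 13`, `β₀ = 1∕7` in `O₄`, `β₀ = b₀ = 1∕F.L` for
the flow letters, `(sS, θc) = (34, 49∕50)`) — a second, independent application of the terminal theorem for every family.
[decided toy] -/
theorem continuumYM4Torus_jointData_all₄ (F : T4Family) : ContinuumYM4Torus (jointData F) := by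
  obtain ⟨hμ, hκ₁, hE₀, hA₀, hβ₀, hLβ, hn₁, hn, hθ, hslack, hE₂, hE₃, hsS, hsmall, hθc0, hθc1, hθcs⟩ := joint_outside_C4F F
  exact continuumYM4Torus_of_histReadingLWL_fsc (jointData F) (isBlockAveraged_jointData F)
    LoopAverage.measurableE_trivial (endStatementBPrinted_jointData F) (betaPertHyp_jointData F)
    (signConventions_jointData F) (thresholdOK_C4F F) hμ 4 1 hκ₁ hE₀ hA₀ hβ₀ hLβ hn₁ hn hθ hslack hE₂ hE₃ hsS hsmall hθc0
    hθc1 hθcs (forSmallCouplings_histReadDataLWL_jointData_C4F F)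

/-- the ∃-form for every family (the `ForSmallCouplings` range of `jointData F` is NOT empty, any `F`). [decided toy] -/
theorem continuumYM4TorusE_jointData_all (F : T4Family) : ContinuumYM4TorusE (jointData F) :=
  continuumYM4TorusE_of_betaPertHyp (betaPertHyp_jointData F) (continuumYM4Torus_jointData_all F)

/-- THE CERTIFICATE FOR EVERY FAMILY IN ONE LINE. [decided toy] -/
theorem jointWitness_all (F : T4Family) : ContinuumYM4Torus (jointData F) ∧ ContinuumYM4TorusE (jointData F) :=
  ⟨continuumYM4Torus_jointData_all F, continuumYM4TorusE_jointData_all F⟩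

end

end Summit.QuantumFields.BalabanUV.T4Continuum.HistoryRealiseCellsRunAssemblyWTVSJointWitnessAll
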